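import Summits.AtomisticToContinuum.Crystallization.Theorems.ExcessDecayLiouvilleCrysEnergyLimit
import Summits.AtomisticToContinuum.Crystallization.Theorems.ChargedEnergyGap.Negative.BlocksBound

/-!
# Crux `BarlowLiouville` (stmt-AtomisticToContinuum-15801), line `Sketch` — the reference energy of the kernel

THE KEY REMARK of the lead's kernel dossier made formal: in the tube price inequality (registered kernel
`stub_priceSlack`, shape `∃ c > 0 ∀ θ > 0 ∃ C ∀ ctr L, c·D − C(L+1)² − θ·n ≤ T − 2·e_ref·n`) the reference
energy `e_ref` may be ANY upper bound of `e⋆ = ⨅_{Q periodic} e_LJ(Q)` — in particular the energy per particle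
of ANY explicit periodic configuration (a relaxed Barlow stacking), since `e⋆ ≤ e(Q₀)` (`e⋆` is a genuine infimum,
`bddBelow_energyPerParticle_lennardJones`, item 0714) and the right-hand side is antitone in the reference when
`n ≥ 0`. So a proof of the kernel never needs the VALUE of `e⋆` (no crystallization lower bound): it compares tube
configurations with the layered family only, and an exotic non-close-packed Lennard-Jones minimiser would only
make the kernel easier.

* `iInf_energyPerParticle_le` — `e⋆ ≤ Q₀.energyPerParticle` for every periodic `Q₀`;
* `price_antitone_reference` — the price inequality with reference `e₂` implies it with any `e₁ ≤ e₂`;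
* `priceSlack_of_reference` — the registered anchor: the slack-shape price with reference `e(Q₀)` implies the
  slack-shape price with reference `e⋆`.
No definitions. [folklore]
-/

noncomputable section

namespace Summit.AtomisticToContinuum.Crystallization.Theorems.DisclinationRationBarlowLiouville

open Literature.MathematicalPhysics.StatisticalMechanics

/-- `e⋆ ≤ e(Q₀)` for every periodic configuration `Q₀` (`e⋆` is an infimum over a set bounded below,
item 0714). [folklore] -/
theorem iInf_energyPerParticle_le (Q₀ : PeriodicConfiguration 3) :
    (⨅ Q : PeriodicConfiguration 3, Q.energyPerParticle lennardJones) ≤ Q₀.energyPerParticle lennardJones :=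
  ciInf_le ChargedEnergyGapNegative.bddBelow_energyPerParticle_lennardJones Q₀

/-- **The price inequality is antitone in the reference energy**: if `c·D − C(L+1)² − θ·n ≤ T − 2e₂·n` with
`n ≥ 0` and `e₁ ≤ e₂`, then the same holds with `e₁`. [folklore] -/
theorem price_antitone_reference {V : Type*} {D n T : V → ℝ → ℝ} {e₁ e₂ : ℝ} (he : e₁ ≤ e₂)
    (hn : ∀ ctr L, 0 ≤ n ctr L)
    (h : ∃ c : ℝ, 0 < c ∧ ∀ θ : ℝ, 0 < θ → ∃ C : ℝ, ∀ ctr L,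
      c * D ctr L - C * (L + 1) ^ 2 - θ * n ctr L ≤ T ctr L - 2 * e₂ * n ctr L) :
    ∃ c : ℝ, 0 < c ∧ ∀ θ : ℝ, 0 < θ → ∃ C : ℝ, ∀ ctr L,
      c * D ctr L - C * (L + 1) ^ 2 - θ * n ctr L ≤ T ctr L - 2 * e₁ * n ctr L := by
  obtain ⟨c, hc, hcθ⟩ := h
  refine ⟨c, hc, fun θ hθ => ?_⟩
  obtain ⟨C, hC⟩ := hcθ θ hθ
  refine ⟨C, fun ctr L => ?_⟩
  have h1 := hC ctr L
  have h2 : 2 * e₁ * n ctr L ≤ 2 * e₂ * n ctr L := by nlinarith [hn ctr L]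
  linarith

/-- **Registered anchor: the kernel may be proved against an explicit reference.** For every periodic `Q₀`,
the slack-shape price inequality with reference `e(Q₀)` (for arbitrary bad-count `D`, point-count `n ≥ 0` and
energy sum `T`) implies the one with reference `e⋆ = ⨅_{Q periodic} e(Q)`. [folklore] -/
theorem priceSlack_of_reference : ∀ (Q₀ : PeriodicConfiguration 3) {V : Type*} (D n T : V → ℝ → ℝ),
    (∀ ctr L, 0 ≤ n ctr L) →
    (∃ c : ℝ, 0 < c ∧ ∀ θ : ℝ, 0 < θ → ∃ C : ℝ, ∀ ctr L,
      c * D ctr L - C * (L + 1) ^ 2 - θ * n ctr L ≤ T ctr L - 2 * Q₀.energyPerParticle lennardJones * n ctr L) →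
    ∃ c : ℝ, 0 < c ∧ ∀ θ : ℝ, 0 < θ → ∃ C : ℝ, ∀ ctr L,
      c * D ctr L - C * (L + 1) ^ 2 - θ * n ctr L ≤
        T ctr L - 2 * (⨅ Q : PeriodicConfiguration 3, Q.energyPerParticle lennardJones) * n ctr L :=
  fun Q₀ _ _ _ _ hn h => price_antitone_reference (iInf_energyPerParticle_le Q₀) hn h

end Summit.AtomisticToContinuum.Crystallization.Theorems.DisclinationRationBarlowLiouville

end
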